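import Literature.NumberTheory.Automorphic.UnitaryGroupSplitPlace
import HarnessLib

/-!
# The local unitary group at a NON-SPLIT place: one place `w ∣ v`, `E ⊗_F F_v = E_w` is a field
(Platonov–Rapinchuk, *Algebraic Groups and Number Theory* (1994), §5.1; Cassels–Fröhlich (1967), Ch. II §10,
Ch. VII Prop. 1.2)

Topic `NumberTheory/Automorphic`; namespace `Literature.NumberTheory.Automorphic` (grouping sub-namespace
`UnitaryGroup`).  Companion of `UnitaryGroupSplitPlace` (the split case).  KERNEL only: proved lemmas; no named
fact, no `sorry`.

Setting of `UnitaryGroupLocalFactors`: `E/F` a quadratic extension of number fields, `c ∈ Gal(E/F)`, `c ≠ 1`, a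
finite place `v` of `F` and a place `w ∣ v` of `E` with `c • w = w` (a NON-SPLIT place: `v` inert or ramified).
Then

* §1 `w` is the ONLY place above `v` (`PlacesOver.eq_of_smul_eq`, `PlacesOver.subsingleton_of_smul_eq`,
  `Nat.card (PlacesOver E v) = 1`): the fibre is `{w, c⁻¹ • w} = {w}`;
* §2 `E_v := E ⊗_F F_v = Π_{w' ∣ v} E_{w'}` (the tree's `LocalRing E v`) is a FIELD (`LocalRing.isField_of_smul_eq`):
  a product of fields over a one-element index type; its elements are read off at `w`
  (`LocalRing.eq_iff_apply_eq`);
* §3 a product over the places above `v` is its factor at `w` (`PlacesOver.prod_eq_of_smul_eq`) — the shape in which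
  "`∏_{w' ∣ v} χ_{w'}(…)`"-type local factors collapse at a non-split place.

Written for the kernel construction of [GelbartRogawski1991, Prop. 3.1.1] behind the cited input `hGRU` of the
Hodge-CM period-theorem package (stage-1 cell `pub-hodgecm`, seat GR-1, 2026-08-21): Kudla's splitting of the
metaplectic cocycle over `U(J)(F_v)` at a non-split place is an argument over the local FIELD `E_w` with its
involution.

## References

* V. Platonov, A. Rapinchuk, *Algebraic Groups and Number Theory* (1994), §5.1 [PlatonovRapinchuk1994].
* J. W. S. Cassels, A. Fröhlich (eds.), *Algebraic Number Theory* (1967), Ch. II §10, Ch. VII Prop. 1.2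
  [CasselsFrohlichANT1967].
-/

set_option autoImplicit false

noncomputable section

open NumberField IsDedekindDomain

namespace Literature.NumberTheory.Automorphic

namespace UnitaryGroup

variable {F E : Type} [Field F] [NumberField F] [Field E] [NumberField E] [Algebra F E]
variable (c : E ≃ₐ[F] E)

/-! ## §1 One place above `v` -/

/-- at a non-split place (`c • w = w`), `c⁻¹ • w = w`: `galInv c w = w`. [cite: CasselsFrohlichANT1967, Ch. VII Prop. 1.2 (ii)] -/
theorem PlacesOver.galInv_eq_self_of_smul_eq {v : HeightOneSpectrum (𝓞 F)} (w : PlacesOver E v)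
    (hw : c • w.1 = w.1) : PlacesOver.galInv c w = w := by
  apply Subtype.ext
  change c⁻¹ • w.1 = w.1
  rw [inv_smul_eq_iff, hw]

/-- **at a non-split place `w` is the only place of `E` above `v`** (the fibre is `{w, c⁻¹ • w}`).
[cite: CasselsFrohlichANT1967, Ch. VII Prop. 1.2 (ii)] -/
theorem PlacesOver.eq_of_smul_eq [Algebra.IsQuadraticExtension F E] (hc : c ≠ 1)
    {v : HeightOneSpectrum (𝓞 F)} (w : PlacesOver E v) (hw : c • w.1 = w.1) (w' : PlacesOver E v) : w' = w := by
  rcases PlacesOver.eq_or_eq_galInv c hc w w' with h | h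
  · exact h
  · rw [h, PlacesOver.galInv_eq_self_of_smul_eq c w hw]

/-- at a non-split place the type of places above `v` is a subsingleton. [cite: CasselsFrohlichANT1967, Ch. VII Prop. 1.2 (ii)] -/
theorem PlacesOver.subsingleton_of_smul_eq [Algebra.IsQuadraticExtension F E] (hc : c ≠ 1)
    {v : HeightOneSpectrum (𝓞 F)} (w : PlacesOver E v) (hw : c • w.1 = w.1) : Subsingleton (PlacesOver E v) :=
  ⟨fun a b => (PlacesOver.eq_of_smul_eq c hc w hw a).trans (PlacesOver.eq_of_smul_eq c hc w hw b).symm⟩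

/-- at a non-split place the fibre above `v` has exactly one element. [cite: CasselsFrohlichANT1967, Ch. VII Prop. 1.2 (ii)] -/
theorem PlacesOver.card_eq_one [Algebra.IsQuadraticExtension F E] (hc : c ≠ 1)
    {v : HeightOneSpectrum (𝓞 F)} (w : PlacesOver E v) (hw : c • w.1 = w.1) : Nat.card (PlacesOver E v) = 1 := by
  haveI := PlacesOver.subsingleton_of_smul_eq c hc w hw
  haveI : Unique (PlacesOver E v) := uniqueOfSubsingleton w
  exact Nat.card_unique

/-! ## §2 `E ⊗_F F_v` is a field at a non-split place -/

/-- at a non-split place an element of `E ⊗ F_v = Π_{w' ∣ v} E_{w'}` is determined by its `w`-component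
(`E ⊗_F F_v = E_w`). [cite: CasselsFrohlichANT1967, Ch. II §10] -/
theorem LocalRing.eq_iff_apply_eq [Algebra.IsQuadraticExtension F E] (hc : c ≠ 1)
    {v : HeightOneSpectrum (𝓞 F)} (w : PlacesOver E v) (hw : c • w.1 = w.1) (x y : LocalRing E v) :
    x = y ↔ x w = y w := by
  refine ⟨fun h => h ▸ rfl, fun h => funext fun w' => ?_⟩
  obtain rfl := PlacesOver.eq_of_smul_eq c hc w hw w'
  exact h

/-- **`E ⊗_F F_v` is a field at a non-split place** (`= E_w` for the unique `w ∣ v`). [cite: CasselsFrohlichANT1967, Ch. II §10] -/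
theorem LocalRing.isField_of_smul_eq [Algebra.IsQuadraticExtension F E] (hc : c ≠ 1)
    {v : HeightOneSpectrum (𝓞 F)} (w : PlacesOver E v) (hw : c • w.1 = w.1) : IsField (LocalRing E v) := by
  refine ⟨⟨0, 1, fun h => zero_ne_one ((LocalRing.eq_iff_apply_eq c hc w hw 0 1).1 h)⟩, mul_comm, ?_⟩
  intro a ha
  have haw : a w ≠ 0 := fun h0 => ha ((LocalRing.eq_iff_apply_eq c hc w hw a 0).2 h0)
  refine ⟨fun w' => (a w')⁻¹, (LocalRing.eq_iff_apply_eq c hc w hw _ _).2 ?_⟩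
  change a w * (a w)⁻¹ = 1
  exact mul_inv_cancel₀ haw

/-! ## §3 Products over the places above `v` -/

/-- at a non-split place a product over the places above `v` is its factor at `w` (one place above `v`).
[cite: CasselsFrohlichANT1967, Ch. VII Prop. 1.2 (ii)] -/
theorem PlacesOver.prod_eq_of_smul_eq [Algebra.IsQuadraticExtension F E] (hc : c ≠ 1)
    {v : HeightOneSpectrum (𝓞 F)} (w : PlacesOver E v) (hw : c • w.1 = w.1) {M : Type*} [CommMonoid M]
    (f : PlacesOver E v → M) : ∏ w' : PlacesOver E v, f w' = f w := by
  haveI := PlacesOver.subsingleton_of_smul_eq c hc w hw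
  haveI : Unique (PlacesOver E v) := uniqueOfSubsingleton w
  rw [Fintype.prod_unique]
  exact congrArg f (Subsingleton.elim _ _)

end UnitaryGroup

end Literature.NumberTheory.Automorphic

end
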